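import Mathlib
import HarnessLib
import Summits.FinalStateConjecture.FinalStateConjecture.Theses.PhaseMixingCapture
import Literature.Geometry.Lorentzian.EventHorizonArea
import Literature.Geometry.Lorentzian.KerrSurfaceGravity
import Literature.Geometry.Lorentzian.TeukolskyRealAxisModeStability

/-!
# Sketch — crux-ideate `stmt-FinalStateConjecture-10606` (`PhaseMixingCapture.NearExtremalKappaCapture`),
# round 1, ideator 3: first lemmas of the idea cards (they need not be proved; they must elaborate)

* Card `second-law-pins-the-gap` (thermodynamic monotonicity decides the Kerr-parameter clauses):
  `areaBudget` (D1, real arithmetic, PROVED), `secondLaw_pins_gap` (D2, over `EventHorizonArea`,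
  PROVED from D1: area monotone + final area = Kerr area + early area ≥ near-extremal budget +
  Bondi mass bound ⇒ the final hole is sub-extremal with `1 − (a_f/M_f)² ≥ (1 − (a/M)²)/100`).
* Card `nash-moser-inherits-kappa-powers` (polynomial functoriality of [Hin26]):
  `newtonKantorovich_polyRadius` (A1, Banach shadow of the Nash–Moser transfer: basin and modulus
  are fixed powers of the linear constant `Λ`), `QuantModeStabilityNearThreshold` (A2, the first
  GR brick: cutoff-resolvent bound for the radial Teukolsky ODE near the superradiant threshold,
  polynomial in `κ⁻¹`, at bounded `(m, λ)`; local predicate `IsRadialTeukolskySolutionWithSource`).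
-/

noncomputable section

open Filter Set Topology
open scoped ENNReal Manifold ContDiff

namespace Summit.FinalStateConjecture.FinalStateConjecture.Cruxes.NearExtremalKappaCapture.SketchIdeator3

open Literature.Geometry.Lorentzian

/-! ## Card `second-law-pins-the-gap` -/

/-- **D1 (area budget; pure real arithmetic, proved).** Write `σ = √(1 − (a/M)²)` (so that the
Kerr horizon area is `A(M,a) = 8π M r₊ = 8π M²(1 + σ)`), let `u ≥ 0` be the relative loss
(`u = C·dist`), and suppose: the final Kerr parameters `(M_f, a_f)` have horizon area
`8π M_f (M_f + √(M_f² − a_f²)) ≥ 8π M²(1 + σ/2)(1 − u)` (area theorem against a trapped collar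
sphere of area `≈ 8πM²(1 + σ/2)`), and `M_f ≤ M(1 + u)` (Bondi mass loss). If `u ≤ σ/16` then
`√(M_f² − a_f²) ≥ M σ/8`: the final hole is sub-extremal with a gap comparable to the initial one. -/
theorem areaBudget {M a Mf af u : ℝ} (hM : 0 < M) (ha : |a| < M) (hMf : 0 < Mf)
    (hu0 : 0 ≤ u) (hu : u ≤ √(1 - (a / M) ^ 2) / 16)
    (hA : M ^ 2 * (1 + √(1 - (a / M) ^ 2) / 2) * (1 - u) ≤ Mf * (Mf + √(Mf ^ 2 - af ^ 2)))
    (hB : Mf ≤ M * (1 + u)) :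
    M * √(1 - (a / M) ^ 2) / 8 ≤ √(Mf ^ 2 - af ^ 2) := by
  set σ : ℝ := √(1 - (a / M) ^ 2) with hσ
  set s : ℝ := √(Mf ^ 2 - af ^ 2) with hs
  have hσ0 : 0 ≤ σ := Real.sqrt_nonneg _
  have hσ1 : σ ≤ 1 := by
    rw [hσ]
    calc √(1 - (a / M) ^ 2) ≤ √1 := Real.sqrt_le_sqrt (by nlinarith [sq_nonneg (a / M)])
      _ = 1 := Real.sqrt_one
  have hs0 : 0 ≤ s := Real.sqrt_nonneg _
  by_contra hlt
  push Not at hlt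
  -- hlt : s < M * σ / 8
  have h1 : Mf * s ≤ Mf * (M * σ / 8) := by
    exact mul_le_mul_of_nonneg_left hlt.le hMf.le
  have h2 : Mf * Mf ≤ (M * (1 + u)) * (M * (1 + u)) := by
    exact mul_le_mul hB hB hMf.le (by positivity)
  have h3 : Mf * (M * σ / 8) ≤ (M * (1 + u)) * (M * σ / 8) := by
    exact mul_le_mul_of_nonneg_right hB (by positivity)
  have h4 : Mf * (Mf + s) ≤ M ^ 2 * ((1 + u) ^ 2 + (1 + u) * σ / 8) := by nlinarith
  have h5 : M ^ 2 * (1 + σ / 2) * (1 - u) ≤ M ^ 2 * ((1 + u) ^ 2 + (1 + u) * σ / 8) :=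
    hA.trans h4
  have hM2 : 0 < M ^ 2 := by positivity
  have h6 : (1 + σ / 2) * (1 - u) ≤ (1 + u) ^ 2 + (1 + u) * σ / 8 := by
    have := h5
    nlinarith
  -- but (1 + σ/2)(1 - u) - (1+u)² - (1+u)σ/8 = 3σ/8 - 3u - u² - 5uσ/8 > 0 for u ≤ σ/16, σ > 0
  have hσpos : 0 < σ := by
    rw [hσ]
    apply Real.sqrt_pos.2
    have h1 : (a / M) ^ 2 < 1 := by
      rw [div_pow, div_lt_one (by positivity)]
      exact sq_lt_sq' (by linarith [abs_lt.1 ha]) (abs_lt.1 ha).2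
    linarith
  -- s < Mσ/8 forced hlt; derive contradiction from h6
  nlinarith [mul_nonneg hu0 hσ0, sq_nonneg u, hu, hσpos, hσ1]

/-- **D2 (the second law pins the extremality gap; proved from D1).** Let `A` be any advanced-time
foliation of the event horizon `∂I⁻(U) ∩ J⁺(ιX)` of a Cauchy development (tree:
`EventHorizonArea`, `horizonArea`). Suppose (i) the horizon area is monotone (the OUTPUT of the
area theorem, tree `VacuumCauchyDevelopment.monotone_horizonArea` under the named fact
`ChruscielEtAl2001_areaTheorem`), (ii) it converges to the Kerr area `8π M_f(M_f + √(M_f² − a_f²))`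
of the final parameters, (iii) some early section has area at least the near-extremal budget
`8π M²(1 + σ/2)(1 − u)` (trapped collar + outer-minimising hull), (iv) `M_f ≤ M(1 + u)` (Bondi),
with `u ≤ σ/16`. Then the final hole is SUB-extremal and its gap `1 − (a_f/M_f)²` is at least
`(1 − (a/M)²)/100` — no κ-explicit estimate was used. -/
theorem secondLaw_pins_gap {X : Type} [TopologicalSpace X] [ChartedSpace E3 X]
    [IsManifold (𝓡 3) ∞ X] [ConnectedSpace X] {D : InitialDataSet (𝓡 3) X}
    {𝒟 : CauchyDevelopment D} {U : Set 𝒟.carrier} (A : EventHorizonArea 𝒟 U)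
    {M a Mf af u : ℝ} (hM : 0 < M) (ha : |a| < M) (hMf : 0 < Mf) (hu0 : 0 ≤ u)
    (hu : u ≤ √(1 - (a / M) ^ 2) / 16)
    (hmono : Monotone A.horizonArea)
    (hlim : Tendsto A.horizonArea atTop
      (𝓝 (ENNReal.ofReal (8 * Real.pi * (Mf * (Mf + √(Mf ^ 2 - af ^ 2)))))))
    (hearly : ∃ v₀ : ℝ,
      ENNReal.ofReal (8 * Real.pi * (M ^ 2 * (1 + √(1 - (a / M) ^ 2) / 2) * (1 - u))) ≤
        A.horizonArea v₀)
    (hmass : Mf ≤ M * (1 + u)) :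
    Kerr.IsSubextremal Mf af ∧ (1 - (a / M) ^ 2) / 100 ≤ 1 - (af / Mf) ^ 2 := by
  obtain ⟨v₀, hv₀⟩ := hearly
  -- the limit dominates every section area, by monotonicity
  have hge : A.horizonArea v₀ ≤ ENNReal.ofReal (8 * Real.pi * (Mf * (Mf + √(Mf ^ 2 - af ^ 2)))) :=
    ge_of_tendsto hlim (Filter.eventually_atTop.2 ⟨v₀, fun v hv ↦ hmono hv⟩)
  have hreal : 8 * Real.pi * (M ^ 2 * (1 + √(1 - (a / M) ^ 2) / 2) * (1 - u)) ≤
      8 * Real.pi * (Mf * (Mf + √(Mf ^ 2 - af ^ 2))) := by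
    have hnn : 0 ≤ 8 * Real.pi * (Mf * (Mf + √(Mf ^ 2 - af ^ 2))) := by positivity
    exact (ENNReal.ofReal_le_ofReal_iff hnn).1 (hv₀.trans hge)
  have hA : M ^ 2 * (1 + √(1 - (a / M) ^ 2) / 2) * (1 - u) ≤ Mf * (Mf + √(Mf ^ 2 - af ^ 2)) := by
    have hpi : 0 < 8 * Real.pi := by positivity
    exact le_of_mul_le_mul_left hreal hpi
  have key := areaBudget hM ha hMf hu0 hu hA hmass
  -- key : M σ / 8 ≤ √(Mf² - af²)
  have hσpos : 0 < √(1 - (a / M) ^ 2) := by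
    apply Real.sqrt_pos.2
    have h1 : (a / M) ^ 2 < 1 := by
      rw [div_pow, div_lt_one (by positivity)]
      exact sq_lt_sq' (by linarith [abs_lt.1 ha]) (abs_lt.1 ha).2
    linarith
  have hspos : 0 < √(Mf ^ 2 - af ^ 2) := lt_of_lt_of_le (by positivity) key
  have hgap : 0 < Mf ^ 2 - af ^ 2 := Real.sqrt_pos.1 hspos
  refine ⟨?_, ?_⟩
  · -- |af| < Mf
    show |af| < Mf
    have hlt2 : af ^ 2 < Mf ^ 2 := by linarith
    exact abs_lt.2 (abs_lt_of_sq_lt_sq' hlt2 hMf.le)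
  · -- quantitative gap: (Mσ/8)² ≤ Mf² - af², Mf ≤ M(1+u) ≤ 17M/16
    have hsq : (M * √(1 - (a / M) ^ 2) / 8) ^ 2 ≤ Mf ^ 2 - af ^ 2 := by
      calc (M * √(1 - (a / M) ^ 2) / 8) ^ 2 ≤ (√(Mf ^ 2 - af ^ 2)) ^ 2 :=
            pow_le_pow_left₀ (by positivity) key 2
        _ = Mf ^ 2 - af ^ 2 := Real.sq_sqrt hgap.le
    have hσsq : (√(1 - (a / M) ^ 2)) ^ 2 = 1 - (a / M) ^ 2 := Real.sq_sqrt (by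
      have h1 : (a / M) ^ 2 < 1 := by
        rw [div_pow, div_lt_one (by positivity)]
        exact sq_lt_sq' (by linarith [abs_lt.1 ha]) (abs_lt.1 ha).2
      linarith)
    have hσ1 : √(1 - (a / M) ^ 2) ≤ 1 := by
      calc √(1 - (a / M) ^ 2) ≤ √1 := Real.sqrt_le_sqrt (by nlinarith [sq_nonneg (a / M)])
        _ = 1 := Real.sqrt_one
    have hu' : u ≤ 1 / 16 := hu.trans (by linarith)
    have hMf' : Mf ≤ M * (17 / 16) := hmass.trans (by nlinarith)
    -- 1 - (af/Mf)² = (Mf² - af²)/Mf²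
    have hMf2 : 0 < Mf ^ 2 := by positivity
    have hrepr : (1 : ℝ) - (af / Mf) ^ 2 = (Mf ^ 2 - af ^ 2) / Mf ^ 2 := by
      field_simp
    rw [hrepr, le_div_iff₀ hMf2]
    -- goal: (1 - (a/M)²)/100 * Mf² ≤ Mf² - af²
    have hM2sq : M ^ 2 * (1 - (a / M) ^ 2) / 64 ≤ Mf ^ 2 - af ^ 2 := by
      have : (M * √(1 - (a / M) ^ 2) / 8) ^ 2 = M ^ 2 * (1 - (a / M) ^ 2) / 64 := by
        rw [div_pow, mul_pow, hσsq]; ring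
      linarith [hsq, this.symm.le]
    have hnn : 0 ≤ 1 - (a / M) ^ 2 := by rw [← hσsq]; positivity
    have hMfsq : Mf ^ 2 ≤ (M * (17 / 16)) ^ 2 :=
      pow_le_pow_left₀ hMf.le hMf' 2
    have hstep : (1 - (a / M) ^ 2) / 100 * Mf ^ 2 ≤ (1 - (a / M) ^ 2) / 100 * (M * (17 / 16)) ^ 2 :=
      mul_le_mul_of_nonneg_left hMfsq (div_nonneg hnn (by norm_num))
    nlinarith [hM2sq, hstep, hnn, sq_nonneg M]

/-! ## Card `nash-moser-inherits-kappa-powers` -/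

/-- **A1 (Newton–Kantorovich with a polynomial radius; Banach shadow of the Nash–Moser transfer).**
If the nonlinear map `P` has a `Λ`-Lipschitz derivative, its derivative at `x₀` is invertible with
inverse of norm `≤ Λ` (`Λ ≥ 1` the "linear constant"), then `P x = y` is solvable for every
`y` within `1/(4Λ³)` of `P x₀`, with `‖x − x₀‖ ≤ 2Λ ‖y − P x₀‖`: BASIN and MODULUS are fixed
negative/positive powers of the linear constant. Dictionary: `Λ ↦ κ^{−q}` (κ-explicit linear
stability) gives basin `κ^{3q}` and modulus `κ^{−q}` — the shape of `NearExtremalKappaCapture`. -/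
theorem newtonKantorovich_polyRadius {E F : Type*} [NormedAddCommGroup E] [NormedSpace ℝ E]
    [CompleteSpace E] [NormedAddCommGroup F] [NormedSpace ℝ F] [CompleteSpace F]
    (P : E → F) (P' : E → E →L[ℝ] F) (x₀ : E) (L : E ≃L[ℝ] F) (Λ : ℝ) (hΛ : 1 ≤ Λ)
    (hP : ∀ x, HasFDerivAt P (P' x) x) (hL : P' x₀ = (L : E →L[ℝ] F))
    (hLip : ∀ x y, ‖P' x - P' y‖ ≤ Λ * ‖x - y‖) (hinv : ‖(L.symm : F →L[ℝ] E)‖ ≤ Λ)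
    (y : F) (hy : ‖y - P x₀‖ ≤ 1 / (4 * Λ ^ 3)) :
    ∃ x : E, P x = y ∧ ‖x - x₀‖ ≤ 2 * Λ * ‖y - P x₀‖ := by
  sorry

/-- Local predicate (flagged): classical solutions of the INHOMOGENEOUS radial Teukolsky ODE with
source `F` on `(r₊, ∞)` — the tree's `Kerr.IsRadialTeukolskySolution` with `= F r` in place of
`= 0` (TdC arXiv:1910.02854, §2.2.3). -/
def IsRadialTeukolskySolutionWithSource (M a s om m lam : ℝ) (F R : ℝ → ℂ) : Prop :=
  ∃ R' R'' : ℝ → ℂ, ∀ r : ℝ, Kerr.rPlus M a < r →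
    HasDerivAt R (R' r) r ∧ HasDerivAt R' (R'' r) r ∧
      (Kerr.delta M a r : ℂ) * R'' r + 2 * ((s + 1 : ℝ) : ℂ) * ((r - M : ℝ) : ℂ) * R' r +
        ((((Kerr.radialK a om m r ^ 2 : ℝ) : ℂ) -
              2 * Complex.I * (s : ℂ) * ((r - M : ℝ) : ℂ) * (Kerr.radialK a om m r : ℂ)) /
              (Kerr.delta M a r : ℂ) +
            4 * Complex.I * (s : ℂ) * (om : ℂ) * (r : ℂ) - (lam : ℂ) - ((a ^ 2 * om ^ 2 : ℝ) : ℂ) +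
            ((2 * a * m * om : ℝ) : ℂ)) * R r = F r

/-- **A2 (quantitative real-axis mode stability near the superradiant threshold, polynomial in
`κ⁻¹`, at bounded `(m, λ)`; first GR brick of the bookkeeping line).** For spin `s` and every
`M > 0` and frequency bound `Λ₀` there are `N, C, ε > 0` and `a₁ < M` such that for all spins
`a ∈ [a₁, M)`, all admissible `(om, m, λ)` with `|m|, |λ| ≤ Λ₀` and `|om − m om₊| ≤ ε`, `om ≠ 0`, every
solution of the inhomogeneous radial ODE with source `F` supported in `[r₁, r₂] ⊆ [r₊ + M, ∞)` and
bounded by `B`, outgoing at `𝓗⁺` and at `𝓘⁺`, obeys `‖R(r)‖ ≤ C κ(M,a)^{−N} (1 + r₂)^N B` on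
`[r₁, r₂]` (`κ = Kerr.surfaceGravity`, `om₊ = Kerr.horizonAngularVelocity`). The bet of the card is
that `N` is finite (TdC Thm 5.1 suggests even `N = 0` at bounded frequency); `N = ∞` for some
bounded family kills the line. -/
def QuantModeStabilityNearThreshold (s : ℝ) : Prop :=
  ∀ M : ℝ, 0 < M → ∀ Λ₀ : ℝ, ∃ (N : ℕ) (C ε a₁ : ℝ), a₁ < M ∧ 0 < ε ∧
    ∀ a : ℝ, a₁ ≤ a → a < M →
      ∀ (om m lam : ℝ), (∃ k : ℤ, 2 * s = k) → (∃ k : ℤ, m - s = k) →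
        |m| ≤ Λ₀ → |lam| ≤ Λ₀ → |om - m * Kerr.horizonAngularVelocity M a| ≤ ε → om ≠ 0 →
        ∀ (F R : ℝ → ℂ) (r₁ r₂ B : ℝ), Kerr.rPlus M a + M ≤ r₁ → r₁ ≤ r₂ →
          (∀ r, r ∉ Set.Icc r₁ r₂ → F r = 0) → (∀ r, ‖F r‖ ≤ B) →
          IsRadialTeukolskySolutionWithSource M a s om m lam F R →
          Kerr.IsOutgoingAtHorizon M a s om m R → Kerr.IsOutgoingAtInfinity M s om R →
            ∀ r ∈ Set.Icc r₁ r₂,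
              ‖R r‖ ≤ C * (Kerr.surfaceGravity M a) ^ (-(N : ℤ)) * (1 + r₂) ^ N * B

/-- Sanity: the crux decl is in scope BY NAME (the cards' transfers conclude this constant). -/
example : Prop := Summit.FinalStateConjecture.FinalStateConjecture.Theses.PhaseMixingCapture.NearExtremalKappaCapture

end Summit.FinalStateConjecture.FinalStateConjecture.Cruxes.NearExtremalKappaCapture.SketchIdeator3

end
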